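import Mathlib
import HarnessLib
import Literature.Combinatorics.Additive.KempermanStructureTheoremNecessity

/-!
# Grynkiewicz 2009, §6 Claim 5 (case `l = 4`): type (II) cannot occur

[cite: Grynkiewicz2009, §6 Claim 5 (proof of Thm 4.1, pp. 25–26: «Suppose we have type (II) … So type (II) cannot occur»)] [tag: critical-pair] [tag: inverse-theorem]

Topic `Literature/Combinatorics/Additive`.  Cell `mm-stpp` (D-0046), seat `mm-stpp-lit` (gen 23); the
port of D. J. Grynkiewicz, *A step beyond Kemperman's structure theorem*, Mathematika **55** (2009)
67–114 continued.  §6 Claim 5, case `l = 4`, the paragraph excluding type (II) for the Kemperman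
decompositions of `(φ_H(A), φ_H(B))` (print pp. 25–26): «Suppose we have type (II).  If say
`a₁ ∈ A₁′`, then (since type (II) implies `|A_x|, |B_y| ≥ 2` for all `x ∈ A` and `y ∈ B`), it follows in
view of (42) that `φ_L(a₁) = φ_L(a₂)` and that `φ_L(b₁) = φ_L(b₂)`.  Furthermore, if `bᵢ ∈ B₁′`, then
`|L/H| = 2`, and if `bᵢ ∈ B₀′`, then `|φ_H(B₀′)| = 2`.  However, since `φ_H(B₀′)` is an arithmetic
progression, and since `{φ_H(b₁), φ_H(b₂)}` is periodic with period `K/H`, it follows that `|L/H| = 2` in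
this latter case as well.  However, `|L/H| = 2` is impossible for type (II) (since the order of the
difference of the arithmetic progression given by KST is at least `|φ_H(A₀′)| + |φ_H(A₁′)| − 1 ≥ 3`).
Therefore, we can assume `a₁, a₂ ∈ A₀′` and `b₁, b₂ ∈ B₀′`.  Hence, since `φ_H({a₁, a₂})` is an
`K/H`-coset with `|K/H| = 2`, and since `φ_H(A₀′)` is an arithmetic progression whose difference generates
the cyclic group `⟨φ_H(A₀′ − a₁)⟩ = ⟨φ_H(B₀′ − b₁)⟩ ≤ L/H`, it follows that
`|φ_H(A₀′)| > ½|⟨φ_H(A₀′ − a₁)⟩|`.  Likewise `|φ_H(B₀′)| > ½|⟨φ_H(B₀′ − b₁)⟩|`, whence Proposition 2.1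
implies that `φ_H(A + B)` is `⟨φ_H(A₀′ − a₁)⟩`-periodic, a contradiction.  So type (II) cannot occur.»

Stated ABSTRACTLY for a pair `(A, B)` in any abelian group `G′` (the print's `G/H`; the successor feeds
`A.image mk`, `B.image mk` from `exists_isKempermanDecompI_image_mk` and the data of
`StepBeyondKempermanFourPairs.lean`): a Kemperman decomposition `A = A₁ ∪ A₀`, `B = B₁ ∪ B₀` (tree
`IsKempermanDecompI Q …`) with `A + B` aperiodic, elements `x, x + d ∈ A`, `y, y + d ∈ B` with `d ≠ 0`,
`2d = 0` (the `K/H`-cosets `{φa₁, φa₂}`, `{φb₁, φb₂}`), and (42) in the form «a representation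
`u + v = x + y` with `u ∈ A`, `v ∈ B` is `(x, y)` or `(x + d, y + d)`».  Then `(A₀, B₀)` is not of
type (II).  ROUTE: `notMem_periodic_of_twoReps` is the print's first half («if `a₁ ∈ A₁′` …»; in the
sub-case `bᵢ ∈ B₁′` we conclude from `|L/H| = 2` that `A₀′` is a full coset, so `A + B` periodic — a
shortcut replacing the order argument), `IsElementaryII.false_of_two_differences` the second half (both
`K/H`-cosets inside the progressions force `ord(d′) ≤ 2(|A₀′| − 1)` and `≤ 2(|B₀′| − 1)`, against
`ord(d′) ≥ |A₀′| + |B₀′| − 1`; this elementary count replaces the print's appeal to Proposition 2.1 —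
flagged deviation, same conclusion).

MAIN RESULTS (0 definitions, 0 named facts; everything PROVED): `IsElementaryII.false_of_two_differences`,
`IsKempermanDecompI.notMem_periodic_of_twoReps`, `IsKempermanDecompI.not_isElementaryII_of_twoReps`.

## References
* D. J. Grynkiewicz, *A step beyond Kemperman's structure theorem*, Mathematika 55 (2009) 67–114,
  doi:10.1112/S0025579300000966, §6 Claim 5 (pp. 25–26), display (42); §2 (type (II))
  [cite: Grynkiewicz2009, Thm 4.1 (proof, Claim 5)] — held `paper:doi-10-1112-s0025579300000966`,
  p0025–p0026 read 2026-08-29.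
-/

namespace Literature.Combinatorics.Additive

open Finset
open scoped Pointwise

universe u

variable {G : Type u} [AddCommGroup G] [DecidableEq G]

/-- In a progression `X` with difference `d′`, two elements `s, s + d ∈ X` give `d = z • d′` with
`0 < |z| < |X|`. [cite: Grynkiewicz2009, §6 Claim 5 («φ_H(A₀′) is an arithmetic progression whose
difference generates …»)] -/
private theorem exists_zsmul_of_mem_apFinset {X : Finset G} {c d' s d : G}
    (hX : X = apFinset c d' #X) (hs : s ∈ X) (hsd : s + d ∈ X) (hd : d ≠ 0) :
    ∃ z : ℤ, z ≠ 0 ∧ z.natAbs < #X ∧ d = z • d' := by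
  rw [hX] at hs hsd
  obtain ⟨i, hi, his⟩ := mem_apFinset.1 hs
  obtain ⟨j, hj, hjs⟩ := mem_apFinset.1 hsd
  have hd' : d = ((j : ℤ) - (i : ℤ)) • d' := by
    have : d = (c + j • d') - (c + i • d') := by rw [hjs, his]; abel
    rw [this, show c + j • d' - (c + i • d') = j • d' - i • d' by abel, sub_zsmul, natCast_zsmul,
      natCast_zsmul]
    abel
  refine ⟨(j : ℤ) - i, fun h0 => hd (by rw [hd', h0, zero_zsmul]), ?_, hd'⟩
  have := card_apFinset_le c d' #X
  omega

/-- **Second half of the paragraph.**  A type (II) pair `(A₀, B₀)` (progressions with a common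
difference `d′` of order `≥ |A₀| + |B₀| − 1`) cannot contain `p, p + d ∈ A₀` and `r, r + d ∈ B₀` with
`d ≠ 0`, `2d = 0`: then `ord(d′)` divides `2z₁` and `2z₂` with `0 < |z₁| < |A₀|`, `0 < |z₂| < |B₀|`,
so `ord(d′) ≤ |A₀| + |B₀| − 2`. [cite: Grynkiewicz2009, §6 Claim 5 (p. 26, «Therefore, we can assume
a₁, a₂ ∈ A₀′ and b₁, b₂ ∈ B₀′ … a contradiction»)] -/
theorem IsElementaryII.false_of_two_differences {A₀ B₀ : Finset G} (hII : IsElementaryII A₀ B₀)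
    {p r d : G} (hp : p ∈ A₀) (hpd : p + d ∈ A₀) (hr : r ∈ B₀) (hrd : r + d ∈ B₀) (hd : d ≠ 0)
    (h2d : d + d = 0) : False := by
  obtain ⟨hA2, hB2, d', ⟨a, hAeq⟩, ⟨b, hBeq⟩, hord⟩ := hII
  obtain ⟨z₁, hz₁, hz₁lt, hdz₁⟩ := exists_zsmul_of_mem_apFinset hAeq hp hpd hd
  obtain ⟨z₂, hz₂, hz₂lt, hdz₂⟩ := exists_zsmul_of_mem_apFinset hBeq hr hrd hd
  have hdvd : ∀ {z : ℤ}, d = z • d' → (addOrderOf d' : ℤ) ∣ 2 * z := by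
    intro z hz
    rw [addOrderOf_dvd_iff_zsmul_eq_zero, ← smul_smul, ← hz, two_zsmul]
    exact h2d
  have h1 := Int.natCast_dvd.1 (hdvd hdz₁)
  have h2 := Int.natCast_dvd.1 (hdvd hdz₂)
  rw [Int.natAbs_mul] at h1 h2
  have h2abs : (2 : ℤ).natAbs = 2 := rfl
  rw [h2abs] at h1 h2
  rcases hord with h0 | hle
  · rw [h0] at h1
    have := Nat.eq_zero_of_zero_dvd h1
    omega
  · have hpos₁ : 0 < 2 * z₁.natAbs := by have := Int.natAbs_pos.2 hz₁; omega
    have hpos₂ : 0 < 2 * z₂.natAbs := by have := Int.natAbs_pos.2 hz₂; omega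
    have hle₁ := Nat.le_of_dvd hpos₁ h1
    have hle₂ := Nat.le_of_dvd hpos₂ h2
    omega

namespace IsKempermanDecompI

/-- **First half of the paragraph: `a₁ ∉ A₁′`.**  For a Kemperman decomposition with quasi-period `Q`,
bottom pair of type (II) and `A + B` aperiodic: if `x + y` (`x ∈ A`, `y ∈ B`) has exactly the two
representations `(x, y)`, `(x + d, y + d)` in `A + B` (`d ≠ 0`, `2d = 0`), then `x` is not in the
periodic part `A₁`.  Otherwise every `v ∈ B` with `v ≡ y (mod Q)` represents `x + y` as
`(x − (v − y)) + v`, so the `Q`-class of `y` in `B` is `⊆ {y, y + d}`: if `y ∈ B₁` this makes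
`Q = {0, d}` and `A₀` a full `Q`-coset, so `A + B` is periodic; if `y ∈ B₀` it makes `B₀ = {y, y + d}` a
progression whose difference has order `2 < |A₀| + |B₀| − 1`.
[cite: Grynkiewicz2009, §6 Claim 5 (pp. 25–26, «If say a₁ ∈ A₁′ …»)] -/
theorem notMem_periodic_of_twoReps {Q : AddSubgroup G} {A B A₁ A₀ B₁ B₀ : Finset G}
    (h : IsKempermanDecompI Q A B A₁ A₀ B₁ B₀) (hII : IsElementaryII A₀ B₀)
    (hap : ¬ IsPeriodic (A + B)) {x y d : G} (hy : y ∈ B) (hd : d ≠ 0) (h2d : d + d = 0)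
    (h42 : ∀ u ∈ A, ∀ v ∈ B, u + v = x + y → (u = x ∧ v = y) ∨ (u = x + d ∧ v = y + d)) :
    x ∉ A₁ := by
  classical
  intro hx
  have hA₁A : A₁ ⊆ A := by rw [← h.decomp_left.union_eq]; exact subset_union_left
  -- the `Q`-class of `y` inside `B` is `⊆ {y, y + d}`
  have hS : ∀ v ∈ B, v - y ∈ Q → v = y ∨ v = y + d := by
    intro v hv hvy
    have hu : x - (v - y) ∈ A₁ := by
      have := vadd_mem_vadd_finset (a := -(v - y)) hx
      rw [h.decomp_left.periodic _ (Q.neg_mem hvy), vadd_eq_add] at this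
      rwa [show x - (v - y) = -(v - y) + x by abel]
    rcases h42 _ (hA₁A hu) v hv (by abel) with ⟨-, h1⟩ | ⟨-, h1⟩
    · exact Or.inl h1
    · exact Or.inr h1
  have hyB : y ∈ B₁ ∪ B₀ := by rw [h.decomp_right.union_eq]; exact hy
  rcases mem_union.1 hyB with hy₁ | hy₀
  · -- `y ∈ B₁`: `Q ⊆ {0, d}`, so `A₀` is a full `Q`-coset and `A + B` is periodic
    have hB₁B : B₁ ⊆ B := by rw [← h.decomp_right.union_eq]; exact subset_union_left
    have hQ : ∀ q ∈ Q, q = 0 ∨ q = d := by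
      intro q hq
      have hmem : q + y ∈ B₁ := by
        have := vadd_mem_vadd_finset (a := q) hy₁
        rwa [h.decomp_right.periodic q hq, vadd_eq_add] at this
      rcases hS _ (hB₁B hmem) (by rw [add_sub_cancel_right]; exact hq) with h1 | h1
      · exact Or.inl (by rw [← add_eq_right (b := y)]; exact h1)
      · exact Or.inr (add_right_cancel (h1.trans (add_comm y d)))
    have hdQ : d ∈ Q := by
      obtain ⟨q, hqQ, hq0⟩ : ∃ q ∈ Q, q ≠ (0 : G) := by
        by_contra hno
        push Not at hno
        exact h.decomp_left.ne_bot ((AddSubgroup.eq_bot_iff_forall _).2 hno)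
      rcases hQ q hqQ with h1 | h1
      · exact absurd h1 hq0
      · rwa [← h1]
    obtain ⟨a₀, ha₀⟩ := h.left_nonempty
    have hsub : A₀ ⊆ {a₀, a₀ + d} := by
      intro a ha
      rw [mem_insert, mem_singleton]
      rcases hQ _ (h.decomp_left.sub_mem a ha a₀ ha₀) with h1 | h1
      · exact Or.inl (sub_eq_zero.1 h1)
      · exact Or.inr (by rw [← h1]; abel)
    have hpair : #({a₀, a₀ + d} : Finset G) = 2 := by
      rw [card_pair]; exact fun h' => hd (by rw [← add_eq_left (a := a₀)]; exact h'.symm)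
    have hA₀eq : A₀ = {a₀, a₀ + d} :=
      eq_of_subset_of_card_le hsub (by rw [hpair]; exact hII.1)
    have hA₀per : IsPeriodicWith Q A₀ := by
      intro q hq
      rcases hQ q hq with h1 | h1 <;> rw [h1]
      · exact zero_vadd _ _
      · rw [hA₀eq]
        ext w
        simp only [mem_vadd_finset, mem_insert, mem_singleton, vadd_eq_add]
        constructor
        · rintro ⟨v, hv | hv, rfl⟩
          · exact Or.inr (by rw [hv, add_comm])
          · exact Or.inl (by rw [hv, show d + (a₀ + d) = a₀ + (d + d) by abel, h2d, add_zero])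
        · rintro (hw | hw)
          · exact ⟨a₀ + d, Or.inr rfl, by
              rw [hw, show d + (a₀ + d) = a₀ + (d + d) by abel, h2d, add_zero]⟩
          · exact ⟨a₀, Or.inl rfl, by rw [hw, add_comm]⟩
    have hAper : IsPeriodicWith Q A := by
      rw [← h.decomp_left.union_eq]; exact h.decomp_left.periodic.union hA₀per
    exact hap ⟨Q, h.decomp_left.ne_bot, hAper.add_right B⟩
  · -- `y ∈ B₀`: `B₀ = {y, y + d}` is a progression whose difference has order `≤ 2`
    have hsub : B₀ ⊆ {y, y + d} := by
      intro v hv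
      rw [mem_insert, mem_singleton]
      have hB₀B : B₀ ⊆ B := by rw [← h.decomp_right.union_eq]; exact subset_union_right
      exact hS v (hB₀B hv) (h.decomp_right.sub_mem v hv y hy₀)
    have hpair : #({y, y + d} : Finset G) = 2 := by
      rw [card_pair]; exact fun h' => hd (by rw [← add_eq_left (a := y)]; exact h'.symm)
    have hB₀eq : B₀ = {y, y + d} :=
      eq_of_subset_of_card_le hsub (by rw [hpair]; exact hII.2.1)
    have hB₀2 : #B₀ = 2 := by rw [hB₀eq, hpair]
    obtain ⟨hA2, -, d', -, hBap, hord⟩ := hII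
    have hd'0 : d' ≠ 0 := hBap.ne_zero (by rw [hB₀2]; norm_num)
    obtain ⟨b, hBeq⟩ := hBap
    rw [hB₀2] at hBeq
    have hb : b ∈ B₀ := by
      rw [hBeq]; exact mem_apFinset.2 ⟨0, by norm_num, by rw [zero_smul, add_zero]⟩
    have hbd : b + d' ∈ B₀ := by
      rw [hBeq]; exact mem_apFinset.2 ⟨1, by norm_num, by rw [one_smul]⟩
    rw [hB₀eq, mem_insert, mem_singleton] at hb hbd
    have h2d' : d' + d' = 0 := by
      rcases hb with hb | hb <;> rcases hbd with hbd | hbd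
      · exact absurd (by rw [← add_eq_left (a := b)]; rw [← hb] at hbd; exact hbd) hd'0
      · have : d' = d := by rw [hb] at hbd; exact add_left_cancel hbd
        rw [this, h2d]
      · have : d' = -d := by
          rw [hb] at hbd
          have := hbd; rw [add_assoc, add_eq_left] at this
          rw [← sub_eq_zero, sub_neg_eq_add, add_comm]; exact this
        rw [this, ← neg_add, h2d, neg_zero]
      · exact absurd (by rw [hb] at hbd; exact (add_eq_left.1 hbd)) hd'0
    have hdvd : addOrderOf d' ∣ 2 := by rw [addOrderOf_dvd_iff_nsmul_eq_zero, two_nsmul, h2d']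
    have hle := Nat.le_of_dvd (by norm_num) hdvd
    rcases hord with h0 | hle'
    · rw [h0] at hdvd; exact absurd (Nat.eq_zero_of_zero_dvd hdvd) (by norm_num)
    · omega

/-- **Type (II) cannot occur (Claim 5, case `l = 4`).**  For a Kemperman decomposition with
`A + B` aperiodic and elements `x, x + d ∈ A`, `y, y + d ∈ B` (`d ≠ 0`, `2d = 0`) such that `x + y` has
exactly the representations `(x, y)`, `(x + d, y + d)` (display (42)): the bottom pair is not of type
(II).  By `notMem_periodic_of_twoReps` (for `x`, `x + d`, and — via the symmetric decomposition — `y`,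
`y + d`) all four lie in `A₀`, `B₀`, and `IsElementaryII.false_of_two_differences` ends it.
[cite: Grynkiewicz2009, §6 Claim 5 (pp. 25–26, «So type (II) cannot occur»)] -/
theorem not_isElementaryII_of_twoReps {Q : AddSubgroup G} {A B A₁ A₀ B₁ B₀ : Finset G}
    (h : IsKempermanDecompI Q A B A₁ A₀ B₁ B₀) (hap : ¬ IsPeriodic (A + B)) {x y d : G}
    (hx : x ∈ A) (hxd : x + d ∈ A) (hy : y ∈ B) (hyd : y + d ∈ B) (hd : d ≠ 0) (h2d : d + d = 0)
    (h42 : ∀ u ∈ A, ∀ v ∈ B, u + v = x + y → (u = x ∧ v = y) ∨ (u = x + d ∧ v = y + d)) :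
    ¬ IsElementaryII A₀ B₀ := by
  intro hII
  have hsum : x + d + (y + d) = x + y := by
    rw [show x + d + (y + d) = x + y + (d + d) by abel, h2d, add_zero]
  have hxdd : x + d + d = x := by rw [add_assoc, h2d, add_zero]
  have hydd : y + d + d = y := by rw [add_assoc, h2d, add_zero]
  -- (42) from the other end and for the swapped pair
  have h42' : ∀ u ∈ A, ∀ v ∈ B, u + v = x + d + (y + d) →
      (u = x + d ∧ v = y + d) ∨ (u = x + d + d ∧ v = y + d + d) := by
    intro u hu v hv huv
    rw [hsum] at huv
    rw [hxdd, hydd]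
    exact (h42 u hu v hv huv).symm
  have h42s : ∀ v ∈ B, ∀ u ∈ A, v + u = y + x → (v = y ∧ u = x) ∨ (v = y + d ∧ u = x + d) := by
    intro v hv u hu hvu
    rcases h42 u hu v hv (by rw [add_comm, hvu, add_comm]) with ⟨h1, h2⟩ | ⟨h1, h2⟩
    · exact Or.inl ⟨h2, h1⟩
    · exact Or.inr ⟨h2, h1⟩
  have h42s' : ∀ v ∈ B, ∀ u ∈ A, v + u = y + d + (x + d) →
      (v = y + d ∧ u = x + d) ∨ (v = y + d + d ∧ u = x + d + d) := by
    intro v hv u hu hvu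
    rw [show y + d + (x + d) = y + x by rw [add_comm (y + d), hsum, add_comm]] at hvu
    rw [hxdd, hydd]
    exact (h42s v hv u hu hvu).symm
  have hBA : ¬ IsPeriodic (B + A) := by rwa [add_comm]
  have hx₁ := h.notMem_periodic_of_twoReps hII hap hy hd h2d h42
  have hxd₁ := h.notMem_periodic_of_twoReps hII hap hyd hd h2d h42'
  have hy₁ := h.symm.notMem_periodic_of_twoReps hII.symm hBA hx hd h2d h42s
  have hyd₁ := h.symm.notMem_periodic_of_twoReps hII.symm hBA hxd hd h2d h42s'
  have memA₀ : ∀ a : G, a ∈ A → a ∉ A₁ → a ∈ A₀ := fun a ha hna => by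
    have h' : a ∈ A₁ ∪ A₀ := by rw [h.decomp_left.union_eq]; exact ha
    exact (mem_union.1 h').resolve_left hna
  have memB₀ : ∀ b : G, b ∈ B → b ∉ B₁ → b ∈ B₀ := fun b hb hnb => by
    have h' : b ∈ B₁ ∪ B₀ := by rw [h.decomp_right.union_eq]; exact hb
    exact (mem_union.1 h').resolve_left hnb
  exact hII.false_of_two_differences (memA₀ _ hx hx₁) (memA₀ _ hxd hxd₁) (memB₀ _ hy hy₁)
    (memB₀ _ hyd hyd₁) hd h2d

end IsKempermanDecompI

end Literature.Combinatorics.Additive
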